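import Summits.QuantumFields.YangMills.Theorems.UnitScaleTiltProp7IterLinStructure
import Literature.MathematicalPhysics.QuantumFieldTheory.Balaban1983to89.B15DeterminingSets
import Literature.MathematicalPhysics.QuantumFieldTheory.Balaban1983to89.B5Eq120IterProof
import Summits.QuantumFields.YangMills.Theorems.UnitScaleTiltProp8ChartHInvComb
import HarnessLib

/-!
# Route `UnitScaleTilt`, crux K1 «MinimiserStabilityRegPr» (stmt-QuantumFields-19200), line «route-R» (`Lines/birth_routeR.lean` v2 5b75208179c6919a),
# stub P `stub_relPoincareOpt` — linear flat core, step N6-A of the P-lin-flat plan (CARD-19200-V3-g11): THE COARSE GAUGE FUNCTION `Λ_k` OF THE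
# STRUCTURE THEOREM `Q^{(k)} = L^kQ_k − ∇Λ_k`, CHARACTERISED BY ITS RECURSION — identity, value on pure gauges, and the propagation of per-level bounds
# with GEOMETRIC weights (the seat of the k-uniformity)

Cell `ym3-torus` ∕ fleet seat `ym-ust-19200-p1` (gen 11, route-R lead).  WHY.  p2's structure theorem `Prop7AvgLinearisation.exists_iterLin_eq_bondAvgIter_sub_grad`
(p526009) gives the coarse site function `Λ_k(Y)` only existentially; the P-lin-flat assembly (CARD-19200-V3-g11 §2, steps N6–N7) needs two more facts about
THE SAME `Λ`: its value on a pure gauge, `Λ_k(∂μ)(y) = (Q′_kμ)(y) − μ(embIter k y)` (so that the constraint read on a Hodge-split field `B + ∂φ` becomes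
`ℓ·M_k(B)(c) + (φ(y′₀) − φ(y₀)) = Λ(B)(y′) − Λ(B)(y)`), and a bound `‖Λ_k(Y)(y) − κ‖ ≤ (Σ_{j<k} a_j)·G_k(y)` propagated from per-level bounds
`‖L^j·combMean(Q_jY)(z) − κ_j‖ ≤ a_j·G_{j+1}(z)` along the nesting of the blocks — with `a_j ∝ L^{j/2}` the sum is GEOMETRIC, `≤ L^{k/2}/(√L − 1)`, which is
where the k-uniformity of P's constant lives.  Following the tree file's own convention («families characterised by their recursions, not defined») `Λ` is
any family with `Λ_0 = 0`, `Λ_{k+1}(y) = L^k·combMean(Q_kY)(y) + Λ_k(emb y)` — p526009's proof term; such a family exists (`exists_iterLambda`, `Nat.rec`).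

WHAT IS PROVED (sorry-free, no definition):
* §1 **`combMean_grad`** (`combMean(∂μ)(y) = (Q′μ)(y) − μ(emb y)`: telescoping `walkSum_grad` along the staircases of (0.3),
  whose ends are the block sites of record, `walkEnd_emb_stairWord_eq_blockSite`).
* §2 **`iterLin_eq_of_iterLambda`** (the identity `Q^{(k)}Y = L^k·Q_kY − ∇Λ_kY` for every recursion family, `k ≤ m + K`; p526009's induction verbatim),
  `exists_iterLambda`.
* §3 **`iterLambda_grad`**: `Λ_k(∂μ)(y) = (Q′_kμ)(y) − μ(embIter k y)` (induction; one step = `combMean_grad` ∘ [Balaban1984PropagatorsI] (1.20)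
  `B5Eq120IterProof.bondAvgIter_grad`).
* §4 **`norm_iterLambda_sub_le`**: per-level bounds with constants `a_j ≥ 0` against a block functional `G` that is monotone along the nesting
  (`G_j(emb y) ≤ G_{j+1}(y)`) propagate to `‖Λ_k(Y)(y) − Σ_{j<k}κ_j‖ ≤ (Σ_{j<k} a_j)·G_k(y)`; `geom_sum_sqrt_le`: `Σ_{j<k} (√L)^j ≤ (√L)^k/(√L − 1)`.

HONEST SCOPE.  Bookkeeping only; the analytic per-level bound (N6-B: `‖L^j·combMean(Q_jY)(z) − κ‖² ≤ (9/4)c_P L^{j+4}·Σ_{B^{j+1}(z)}‖∇Y‖²` by the cube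
Poincaré inequality `B4Block227`) and the assembly N7 are separate files.  Nothing of Bałaban's analysis is asserted.

References: T. Bałaban, CMP 95 (1984) 17–40 [Balaban1984PropagatorsI] ((1.13), (1.18)–(1.20) pp.19–20); CMP 98 (1985) 17–51 [Balaban1985Averaging]
((11) p.18, (62) p.28, (124)–(125) p.36); CMP 102 (1985) 277–309 [Balaban1985Variational] (Prop. 7 p.299).
-/

noncomputable section

open scoped BigOperators Matrix.Norms.L2Operator Matrix
open Function

namespace Summit.QuantumFields.YangMills.Theorems.Prop7IterLinStructureRec

open Literature.MathematicalPhysics.QuantumFieldTheory.Balaban1983to89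
open T4Continuum AveragingRT BlockAveraging BlockAveragingEMLLinearised LatticeFieldCalculus
open B15DeterminingSets (embIter)
open B5Eq120IterProof (bondAvgIter_grad siteAvgIter_zero siteAvgIter_succ)
open Summit.QuantumFields.YangMills.Theorems.Prop7LinAvgOnto (linAvg_add)
open Summit.QuantumFields.YangMills.Theorems.Prop7AvgLinearisation (linAvg_nsmul linAvg_sub)
open Summit.QuantumFields.YangMills.Theorems.ChartHInv (combMean_real_smul)

variable {P : Params} {n : Type*} [Fintype n] [DecidableEq n] [Nonempty n]

/-! ## §1 The comb mean of a pure gauge (linearity: `ChartHInv.combMean_real_smul`, p1 g-lineage, imported) -/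

omit [Fintype n] [DecidableEq n] [Nonempty n] in
/-- **THE COMB MEAN OF A PURE GAUGE**: `combMean(∂μ)(y) = (Q′μ)(y) − μ(emb y)` — every staircase of (0.3) from the centre `emb y` telescopes to
`μ(end) − μ(emb y)`, and the ends are the block sites of record, whose plain mean is `Q′μ(y)`. [cite: Balaban1985Averaging, (62) p.28] -/
theorem combMean_grad {j : ℕ} (μ : Site P j → Matrix n n ℂ) (y : Site P (j + 1)) :
    combMean (fun b : PBond P j => μ b.tgt - μ b.src) y = siteAvg μ y - μ (emb y) := by
  rw [combMean_def]
  have hterm : ∀ i : Idx P, walkSum (fun b : PBond P j => μ b.tgt - μ b.src) (walk (emb y) (stairWord i.2.1 (off i.1)))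
      = μ (Site.blockSite y i.1) - μ (emb y) := fun i => by
    rw [walkSum_grad, walkEnd_emb_stairWord_eq_blockSite]
  rw [Finset.sum_congr rfl fun i _ => hterm i, Finset.sum_sub_distrib, Finset.sum_const, Finset.card_univ, smul_sub,
    sum_idx_of_fst (fun r => μ (Site.blockSite y r))]
  have hI : (Fintype.card (Idx P) : ℂ) ≠ 0 := Nat.cast_ne_zero.mpr Fintype.card_pos.ne'
  have hS : (Fintype.card (Equiv.Perm (Fin P.d)) : ℂ) ≠ 0 := Nat.cast_ne_zero.mpr Fintype.card_pos.ne'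
  congr 1
  · -- `|I|⁻¹·|S_d|²·Σ_r = L^{−d}·Σ_r`
    rw [siteAvg, RCLike.real_smul_eq_coe_smul (K := ℂ), ← Nat.cast_smul_eq_nsmul ℂ, smul_smul, card_idx]
    congr 1
    push_cast
    field_simp
  · rw [← Nat.cast_smul_eq_nsmul ℂ, smul_smul, inv_mul_cancel₀ hI, one_smul]

/-! ## §2 The coarse gauge function of the structure theorem, characterised by its recursion -/

omit [Fintype n] [DecidableEq n] [Nonempty n] in
/-- **`Q^{(k)}Y = L^k·Q_kY − ∇Λ_kY` FOR EVERY RECURSION FAMILY** `Λ_0 = 0`, `Λ_{k+1}(y) = L^k·combMean(Q_kY)(y) + Λ_k(emb y)` (`k ≤ m + K`) — p526009's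
induction with the gauge function exposed. [cite: Balaban1984PropagatorsI, (1.18)-(1.20) pp.19-20; Balaban1985Averaging, (124)-(125) p.36] -/
theorem iterLin_eq_of_iterLambda
    (Q : (i : ℕ) → (PBond P 0 → Matrix n n ℂ) → PBond P i → Matrix n n ℂ)
    (hQ0 : ∀ Y, Q 0 Y = Y) (hQs : ∀ (i : ℕ) (Y : PBond P 0 → Matrix n n ℂ) (c : PBond P (i + 1)), Q (i + 1) Y c = linAvg (Q i Y) c)
    (Y : PBond P 0 → Matrix n n ℂ) (Λ : (k : ℕ) → Site P k → Matrix n n ℂ) (hΛ0 : ∀ y, Λ 0 y = 0)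
    (hΛs : ∀ (k : ℕ) (y : Site P (k + 1)), Λ (k + 1) y = (P.L ^ k : ℕ) • combMean (bondAvgIter k Y) y + Λ k (emb y)) :
    ∀ k : ℕ, k ≤ P.m + P.K → ∀ c : PBond P k, Q k Y c = (P.L ^ k : ℕ) • bondAvgIter k Y c - (Λ k c.tgt - Λ k c.src) := by
  intro k
  induction k with
  | zero =>
    intro _ c
    rw [hQ0, pow_zero, one_smul, hΛ0, hΛ0, sub_self, sub_zero]
    rfl
  | succ k ih =>
    intro hk c
    have hΛ := ih (Nat.le_of_succ_le hk)
    have hfun : Q k Y = fun b : PBond P k => (P.L ^ k : ℕ) • bondAvgIter k Y b - (Λ k b.tgt - Λ k b.src) := funext hΛ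
    rw [hQs, hfun, linAvg_sub (fun b : PBond P k => (P.L ^ k : ℕ) • bondAvgIter k Y b) (fun b => Λ k b.tgt - Λ k b.src) c,
      linAvg_nsmul, linAvg_grad, linAvg_eq_bondAvg_sub_grad_combMean, hΛs, hΛs]
    have hiter : bondAvgIter (k + 1) Y = bondAvg (bondAvgIter k Y) := rfl
    rw [hiter, pow_succ, mul_smul, Nat.cast_smul_eq_nsmul ℂ, smul_sub, smul_sub]
    simp only [sub_eq_add_neg, neg_add, neg_neg]
    abel

omit [Fintype n] [DecidableEq n] [Nonempty n] in
/-- A recursion family exists (structural recursion on the level). [folklore] -/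
theorem exists_iterLambda (Y : PBond P 0 → Matrix n n ℂ) :
    ∃ Λ : (k : ℕ) → Site P k → Matrix n n ℂ, (∀ y, Λ 0 y = 0) ∧
      ∀ (k : ℕ) (y : Site P (k + 1)), Λ (k + 1) y = (P.L ^ k : ℕ) • combMean (bondAvgIter k Y) y + Λ k (emb y) :=
  ⟨fun k => Nat.rec (motive := fun k => Site P k → Matrix n n ℂ) (fun _ => 0)
      (fun k Λk y => (P.L ^ k : ℕ) • combMean (bondAvgIter k Y) y + Λk (emb y)) k,
    fun _ => rfl, fun _ _ => rfl⟩

omit [Fintype n] [DecidableEq n] [Nonempty n] in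
/-- **THE STRUCTURE THEOREM WITH THE GAUGE FUNCTION EXPOSED**: for every fine `Y` there is a recursion family `Λ` (hence with all the properties of §3–§4)
such that `Q^{(k)}Y = L^k·Q_kY − ∇Λ_kY` for all `k ≤ m + K`. [cite: Balaban1984PropagatorsI, (1.18)-(1.20) pp.19-20] -/
theorem exists_iterLambda_eq
    (Q : (i : ℕ) → (PBond P 0 → Matrix n n ℂ) → PBond P i → Matrix n n ℂ)
    (hQ0 : ∀ Y, Q 0 Y = Y) (hQs : ∀ (i : ℕ) (Y : PBond P 0 → Matrix n n ℂ) (c : PBond P (i + 1)), Q (i + 1) Y c = linAvg (Q i Y) c)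
    (Y : PBond P 0 → Matrix n n ℂ) :
    ∃ Λ : (k : ℕ) → Site P k → Matrix n n ℂ, (∀ y, Λ 0 y = 0) ∧
      (∀ (k : ℕ) (y : Site P (k + 1)), Λ (k + 1) y = (P.L ^ k : ℕ) • combMean (bondAvgIter k Y) y + Λ k (emb y)) ∧
      ∀ k : ℕ, k ≤ P.m + P.K → ∀ c : PBond P k, Q k Y c = (P.L ^ k : ℕ) • bondAvgIter k Y c - (Λ k c.tgt - Λ k c.src) := by
  obtain ⟨Λ, h0, hs⟩ := exists_iterLambda (P := P) Y
  exact ⟨Λ, h0, hs, iterLin_eq_of_iterLambda Q hQ0 hQs Y Λ h0 hs⟩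

/-! ## §3 The gauge function on a pure gauge -/

omit [Fintype n] [DecidableEq n] [Nonempty n] in
/-- **`Λ_k(∂μ)(y) = (Q′_kμ)(y) − μ(embIter k y)`**: on the pure gauge `Y = ∂μ` the recursion telescopes — `Q_k(∂μ) = L^{−k}∂(Q′_kμ)` ((1.20)), so
`L^k·combMean(Q_k∂μ)(y) = combMean(∂Q′_kμ)(y) = Q′_{k+1}μ(y) − Q′_kμ(emb y)` (§1). [cite: Balaban1984PropagatorsI, (1.20) p.20; Balaban1985Averaging, (11) p.18] -/
theorem iterLambda_grad (μ : Site P 0 → Matrix n n ℂ) (Λ : (k : ℕ) → Site P k → Matrix n n ℂ) (hΛ0 : ∀ y, Λ 0 y = 0)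
    (hΛs : ∀ (k : ℕ) (y : Site P (k + 1)),
      Λ (k + 1) y = (P.L ^ k : ℕ) • combMean (bondAvgIter k (fun b : PBond P 0 => μ b.tgt - μ b.src)) y + Λ k (emb y)) :
    ∀ k : ℕ, k ≤ P.m + P.K → ∀ y : Site P k, Λ k y = siteAvgIter k μ y - μ (embIter k y) := by
  intro k
  induction k with
  | zero =>
    intro _ y
    rw [hΛ0, siteAvgIter_zero]
    exact (sub_self _).symm
  | succ k ih =>
    intro hk y
    have hk' : k ≤ P.m + P.K := Nat.le_of_succ_le hk
    rw [hΛs, ih hk' (emb y)]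
    -- `Q_k(∂μ) = ∂^{1/L^k}(Q′_kμ)`
    have hY : (fun b : PBond P 0 => μ b.tgt - μ b.src) = grad 1 μ := by
      funext b; simp [grad]
    have hQ : bondAvgIter k (fun b : PBond P 0 => μ b.tgt - μ b.src)
        = fun b : PBond P k => ((P.L : ℝ) ^ k)⁻¹ • (siteAvgIter k μ b.tgt - siteAvgIter k μ b.src) := by
      rw [hY, bondAvgIter_grad k hk' 1 μ]
      funext b
      simp [grad, one_div]
    rw [hQ, combMean_real_smul, combMean_grad]
    have hL : ((P.L : ℝ) ^ k) ≠ 0 := pow_ne_zero _ (Nat.cast_ne_zero.mpr P.L_pos.ne')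
    have hone : ((P.L ^ k : ℕ) : ℝ) * ((P.L : ℝ) ^ k)⁻¹ = 1 := by push_cast; exact mul_inv_cancel₀ hL
    rw [← Nat.cast_smul_eq_nsmul ℝ (P.L ^ k), smul_smul, hone, one_smul, ← siteAvgIter_succ]
    show siteAvgIter (k + 1) μ y - siteAvgIter k μ (emb y) + (siteAvgIter k μ (emb y) - μ (embIter k (emb y)))
      = siteAvgIter (k + 1) μ y - μ (embIter (k + 1) y)
    have : embIter (k + 1) y = embIter k (emb y) := rfl
    rw [this]
    abel

/-! ## §4 Propagation of per-level bounds along the nesting (geometric weights) -/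

omit [Nonempty n] in
/-- **PROPAGATION**: if every level contributes `‖L^j·combMean(Q_jY)(z) − κ_j‖ ≤ a_j·G_{j+1}(z)` with `a_j ≥ 0` and the block functional `G` is monotone
along the nesting (`G_j(emb y) ≤ G_{j+1}(y)`: the j-block of the centre of a (j+1)-block lies inside it), then
`‖Λ_k(Y)(y) − Σ_{j<k} κ_j‖ ≤ (Σ_{j<k} a_j)·G_k(y)`. [folklore] -/
theorem norm_iterLambda_sub_le (Y : PBond P 0 → Matrix n n ℂ) (Λ : (k : ℕ) → Site P k → Matrix n n ℂ) (hΛ0 : ∀ y, Λ 0 y = 0)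
    (hΛs : ∀ (k : ℕ) (y : Site P (k + 1)), Λ (k + 1) y = (P.L ^ k : ℕ) • combMean (bondAvgIter k Y) y + Λ k (emb y))
    (κ : ℕ → Matrix n n ℂ) (a : ℕ → ℝ) (ha : ∀ j, 0 ≤ a j) (G : (k : ℕ) → Site P k → ℝ)
    (hG : ∀ (k : ℕ) (y : Site P (k + 1)), G k (emb y) ≤ G (k + 1) y)
    (hlev : ∀ (k : ℕ) (y : Site P (k + 1)), ‖(P.L ^ k : ℕ) • combMean (bondAvgIter k Y) y - κ k‖ ≤ a k * G (k + 1) y) :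
    ∀ (k : ℕ) (y : Site P k), ‖Λ k y - ∑ j ∈ Finset.range k, κ j‖ ≤ (∑ j ∈ Finset.range k, a j) * G k y := by
  intro k
  induction k with
  | zero => intro y; simp [hΛ0]
  | succ k ih =>
    intro y
    have hsum : 0 ≤ ∑ j ∈ Finset.range k, a j := Finset.sum_nonneg fun j _ => ha j
    have hGk : G k (emb y) ≤ G (k + 1) y := hG k y
    rw [hΛs, Finset.sum_range_succ, Finset.sum_range_succ]
    calc ‖(P.L ^ k : ℕ) • combMean (bondAvgIter k Y) y + Λ k (emb y) - (∑ j ∈ Finset.range k, κ j + κ k)‖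
        = ‖((P.L ^ k : ℕ) • combMean (bondAvgIter k Y) y - κ k) + (Λ k (emb y) - ∑ j ∈ Finset.range k, κ j)‖ := by
          congr 1; abel
      _ ≤ ‖(P.L ^ k : ℕ) • combMean (bondAvgIter k Y) y - κ k‖ + ‖Λ k (emb y) - ∑ j ∈ Finset.range k, κ j‖ := norm_add_le _ _
      _ ≤ a k * G (k + 1) y + (∑ j ∈ Finset.range k, a j) * G k (emb y) := add_le_add (hlev k y) (ih (emb y))
      _ ≤ a k * G (k + 1) y + (∑ j ∈ Finset.range k, a j) * G (k + 1) y := by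
          have := mul_le_mul_of_nonneg_left hGk hsum
          linarith
      _ = (∑ j ∈ Finset.range k, a j + a k) * G (k + 1) y := by ring

/-- **THE GEOMETRIC SUM** behind the k-uniformity: for `L > 1`, `Σ_{j<k} (√L)^j ≤ (√L)^k/(√L − 1)`. [folklore] -/
theorem geom_sum_sqrt_le {L : ℝ} (hL : 1 < L) (k : ℕ) :
    ∑ j ∈ Finset.range k, Real.sqrt L ^ j ≤ Real.sqrt L ^ k / (Real.sqrt L - 1) := by
  have hs : 1 < Real.sqrt L := by
    rw [show (1 : ℝ) = Real.sqrt 1 from Real.sqrt_one.symm]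
    exact Real.sqrt_lt_sqrt zero_le_one hL
  have hpos : 0 < Real.sqrt L - 1 := sub_pos.mpr hs
  rw [geom_sum_eq (ne_of_gt hs), le_div_iff₀ hpos, div_mul_cancel₀ _ (ne_of_gt hpos)]
  have : 0 ≤ (1 : ℝ) := zero_le_one
  linarith [pow_pos (lt_trans zero_lt_one hs) k]

end Summit.QuantumFields.YangMills.Theorems.Prop7IterLinStructureRec

end
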